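import Summits.AtomisticToContinuum.HydrodynamicLimit.Theorems.CollisionIsometryCLTMacroClosureEngineObsCommutator
import HarnessLib

/-!
# Sub-goal `engine_blockClosure` of the lead's stub `stub_engine` (line `IdeatorTwoGen1Sketch`, crux
# `MacroClosure`, stmt-AtomisticToContinuum-14870) — helpers A: commutators and block algebra

Support file (`--supports stmt-AtomisticToContinuum-14870`) for the registered sub-goal
`Barycentric.engine_blockClosure` (closing the block production with CTL + FMR). Deterministic,
configuration-wise tools, all in the namespace `Barycentric.EngineBlockClosure`:

* `commutator_one`, `commutator_velocity` — the mollifier commutator of (B4) for weights that are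
  Lipschitz in the minimal-image distance, and its velocity-dependent version
  `|⟨emp, W⟩ − ∫ₓ ⟨emp, φ(· − x) W(x, ·)⟩| ≤ r K ⟨emp, 1 + |v|³⟩` for weights `W(x, v)` that are
  `K(1 + |v|³)`-Lipschitz in `x` (one-particle commutators summed over the particles);
* `lipschitz_kineticWeight` — the kinetic weight
  `W = a + Σⱼ vⱼ aⱼ + Σⱼ mⱼ vⱼ + e |v|²/2 + Σⱼₖ Mⱼₖ vⱼvₖ + Σⱼ Eⱼ vⱼ|v|²/2` of the production `kinFlux`
  is `20 L (1 + |v|³)`-Lipschitz in `x` when its twenty coefficient fields are `L`-Lipschitz;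
* `smoothed_weight_block` — its block average `⟨emp, φ(· − x) W(x, ·)⟩` in the block fields, through
  the exact kinetic-flux algebra (B3);
* `eulerFlux_bU`, `pointwise_identity` — the hs-Euler fluxes at the block state and the pointwise
  algebraic identity "block production density = smoothed kinetic weight + collisional closure −
  kinetic remainder", in which the pressure `p(ρ̄, θ̄)` cancels exactly;
* `rem_abs_le` — the kinetic remainder `Σⱼₖ Mⱼₖ Dⱼₖ + Σⱼ Eⱼ (Σₖ Dⱼₖ ūₖ + qⱼ)` is at most
  `12 L (1 + |ū|) (Σ D² + |q|²)^{1/2}`.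
-/

noncomputable section

open MeasureTheory Filter Set Topology InformationTheory
open scoped ENNReal ContDiff

namespace Summit.AtomisticToContinuum.HydrodynamicLimit.Theorems.MacroClosureLine

open Literature.MathematicalPhysics.KineticTheory Literature.Analysis.FluidPDE
open Literature.Analysis.FunctionSpaces

namespace Barycentric

namespace EngineBlockClosure

/-! ## Velocity weights -/

/-- The moments `‖v‖, ‖v‖², ‖v‖²/2` are at most `1 + ‖v‖³`. -/
theorem moments_le (v : V3) :
    ‖v‖ ≤ 1 + ‖v‖ ^ 3 ∧ ‖v‖ ^ 2 ≤ 1 + ‖v‖ ^ 3 ∧ ‖v‖ ^ 2 / 2 ≤ 1 + ‖v‖ ^ 3 := by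
  have h0 := norm_nonneg v
  have h1 := mul_nonneg h0 (sq_nonneg (‖v‖ - 1))
  refine ⟨?_, ?_, ?_⟩ <;> nlinarith [sq_nonneg (‖v‖ - 1), sq_nonneg ‖v‖]

/-! ## Mollifier commutators for Lipschitz weights -/

/-- One-particle mollifier commutator for a weight that is `K`-Lipschitz in the minimal-image
distance: `|w p − ∫ₓ w(x) φ(p − x) dx| ≤ r K` for a kernel `φ ≥ 0` of unit mass supported in
`{euclidDist(·, 0) < r}`. -/
theorem commutator_one {φ : T3 → ℝ} {r K : ℝ} (hφ0 : ∀ y, 0 ≤ φ y) (hφi : Integrable φ)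
    (hφ1 : ∫ y, φ y = 1) (hsupp : ∀ y, r ≤ Torus.euclidDist y 0 → φ y = 0) {w : T3 → ℝ}
    (hw : Continuous w) (hK0 : 0 ≤ K) (hK : ∀ x y, |w x - w y| ≤ K * Torus.euclidDist x y)
    (p : T3) : |w p - ∫ x, w x * φ (p - x)| ≤ r * K := by
  -- adapted from `Barycentric.B4.abs_sub_integral_mul_translate_le` (gradient bound ↦ Lipschitz bound)
  have h1 : ∫ x, φ (p - x) = 1 := by rw [MesoLLN.integral_comp_sub_left φ p, hφ1]
  have hint : Integrable (fun x => φ (p - x)) := B4.integrable_comp_sub_left hφi p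
  have hint2 : Integrable (fun x => w x * φ (p - x)) := B4.integrable_mul_comp_sub_left hw hφi p
  have hint3 : Integrable (fun x => (w p - w x) * φ (p - x)) :=
    B4.integrable_mul_comp_sub_left (continuous_const.sub hw) hφi p
  have hpt : ∀ x, |w p - w x| * φ (p - x) ≤ r * K * φ (p - x) := by
    intro x
    by_cases hx : φ (p - x) = 0
    · rw [hx, mul_zero, mul_zero]
    · have hlt : Torus.euclidDist p x < r := by
        rw [← MesoLLN.euclidDist_sub_zero]
        by_contra h
        exact hx (hsupp _ (le_of_not_gt h))
      refine mul_le_mul_of_nonneg_right ?_ (hφ0 _)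
      calc |w p - w x| ≤ K * Torus.euclidDist p x := hK p x
        _ ≤ K * r := mul_le_mul_of_nonneg_left hlt.le hK0
        _ = r * K := mul_comm _ _
  have hrepr : w p - ∫ x, w x * φ (p - x) = ∫ x, (w p - w x) * φ (p - x) := by
    simp_rw [sub_mul]
    rw [integral_sub (hint.const_mul _) hint2, integral_const_mul, h1, mul_one]
  rw [hrepr]
  calc |∫ x, (w p - w x) * φ (p - x)| ≤ ∫ x, |(w p - w x) * φ (p - x)| :=
        abs_integral_le_integral_abs
    _ ≤ ∫ x, r * K * φ (p - x) := by
        refine integral_mono hint3.abs (hint.const_mul _) fun x => ?_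
        dsimp only
        rw [abs_mul, abs_of_nonneg (hφ0 _)]
        exact hpt x
    _ = r * K := by rw [integral_const_mul, h1, mul_one]

variable {n : ℕ}

/-- **Mollifier commutator for velocity-dependent weights.** If `x ↦ W x v` is continuous and
`K (1 + ‖v‖³)`-Lipschitz in the minimal-image distance for every `v`, then
`|⟨emp w, W⟩ − ∫ₓ ⟨emp w, φ(· − x) W(x, ·)⟩ dx| ≤ r K ⟨emp w, 1 + |v|³⟩`. -/
theorem commutator_velocity {φ : T3 → ℝ} {r K : ℝ} (hφ0 : ∀ y, 0 ≤ φ y) (hφc : Continuous φ)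
    (hφ1 : ∫ y, φ y = 1) (hsupp : ∀ y, r ≤ Torus.euclidDist y 0 → φ y = 0) (W : T3 → V3 → ℝ)
    (hWc : ∀ v, Continuous fun x => W x v) (hK0 : 0 ≤ K)
    (hW : ∀ x y v, |W x v - W y v| ≤ K * (1 + ‖v‖ ^ 3) * Torus.euclidDist x y)
    (w : Config (n + 1) (Fin 3) T3) :
    |(∫ y, W y.1 y.2 ∂(empiricalMeasure w)) -
        ∫ x, ∫ y, φ (y.1 - x) * W x y.2 ∂(empiricalMeasure w)| ≤
      r * K * ∫ y, (1 + ‖y.2‖ ^ 3) ∂(empiricalMeasure w) := by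
  have hφi : Integrable φ := integrable_of_continuous_T3 hφc
  have key : ∀ i : Fin (n + 1),
      |W (w i).1 (w i).2 - ∫ x, φ ((w i).1 - x) * W x (w i).2| ≤ r * (K * (1 + ‖(w i).2‖ ^ 3)) := by
    intro i
    have h := commutator_one hφ0 hφi hφ1 hsupp (hWc (w i).2) (by positivity)
      (fun x y => hW x y (w i).2) (w i).1
    rwa [integral_congr_ae (Eventually.of_forall fun x => mul_comm (W x (w i).2) (φ ((w i).1 - x)))]
      at h
  have hint : ∀ i : Fin (n + 1), Integrable (fun x => φ ((w i).1 - x) * W x (w i).2) := fun i =>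
    (B4.integrable_mul_comp_sub_left (hWc _) hφi (w i).1).congr
      (Eventually.of_forall fun x => mul_comm _ _)
  have hc0 : (0 : ℝ) ≤ ((n + 1 : ℕ) : ℝ)⁻¹ := inv_nonneg.2 (Nat.cast_nonneg _)
  have hA : ∫ y, W y.1 y.2 ∂(empiricalMeasure w) = ((n + 1 : ℕ) : ℝ)⁻¹ * ∑ i, W (w i).1 (w i).2 :=
    integral_empiricalMeasure w _
  have hI : ∀ x, ∫ y, φ (y.1 - x) * W x y.2 ∂(empiricalMeasure w) =
      ((n + 1 : ℕ) : ℝ)⁻¹ * ∑ i, φ ((w i).1 - x) * W x (w i).2 := fun x =>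
    integral_empiricalMeasure w _
  have hG : ∫ y, (1 + ‖y.2‖ ^ 3) ∂(empiricalMeasure w) =
      ((n + 1 : ℕ) : ℝ)⁻¹ * ∑ i, (1 + ‖(w i).2‖ ^ 3) := integral_empiricalMeasure w _
  have hB : ∫ x, ∫ y, φ (y.1 - x) * W x y.2 ∂(empiricalMeasure w) =
      ((n + 1 : ℕ) : ℝ)⁻¹ * ∑ i, ∫ x, φ ((w i).1 - x) * W x (w i).2 := by
    simp_rw [hI]
    rw [integral_const_mul, integral_finsetSum _ fun i _ => hint i]
  rw [hA, hB, hG, ← mul_sub, ← Finset.sum_sub_distrib, abs_mul, abs_of_nonneg hc0]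
  calc ((n + 1 : ℕ) : ℝ)⁻¹ * |∑ i, (W (w i).1 (w i).2 - ∫ x, φ ((w i).1 - x) * W x (w i).2)|
      ≤ ((n + 1 : ℕ) : ℝ)⁻¹ * ∑ i, r * (K * (1 + ‖(w i).2‖ ^ 3)) :=
        mul_le_mul_of_nonneg_left
          ((Finset.abs_sum_le_sum_abs _ _).trans (Finset.sum_le_sum fun i _ => key i)) hc0
    _ = r * K * (((n + 1 : ℕ) : ℝ)⁻¹ * ∑ i, (1 + ‖(w i).2‖ ^ 3)) := by
        rw [Finset.mul_sum, Finset.mul_sum, Finset.mul_sum]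
        exact Finset.sum_congr rfl fun i _ => by ring

/-! ## The kinetic weight: Lipschitz bound, continuity, block average -/

/-- The kinetic weight of `kinFlux` is `20 L (1 + |v|³)`-Lipschitz in the position when its
coefficient fields are `L`-Lipschitz (minimal-image distance). -/
theorem lipschitz_kineticWeight {L : ℝ} (hL : 0 ≤ L) (A0 Et : T3 → ℝ) (Ax Mt Ex : Fin 3 → T3 → ℝ)
    (Mx : Fin 3 → Fin 3 → T3 → ℝ)
    (hA0 : ∀ x y, |A0 x - A0 y| ≤ L * Torus.euclidDist x y)
    (hEt : ∀ x y, |Et x - Et y| ≤ L * Torus.euclidDist x y)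
    (hAx : ∀ j x y, |Ax j x - Ax j y| ≤ L * Torus.euclidDist x y)
    (hMt : ∀ j x y, |Mt j x - Mt j y| ≤ L * Torus.euclidDist x y)
    (hEx : ∀ j x y, |Ex j x - Ex j y| ≤ L * Torus.euclidDist x y)
    (hMx : ∀ j k x y, |Mx j k x - Mx j k y| ≤ L * Torus.euclidDist x y) (x y : T3) (v : V3) :
    |(A0 x + (∑ j, v j * Ax j x) + (∑ j, Mt j x * v j) + Et x * (‖v‖ ^ 2 / 2) +
        (∑ j, ∑ k, Mx j k x * (v j * v k)) + ∑ j, Ex j x * (v j * (‖v‖ ^ 2 / 2))) -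
      (A0 y + (∑ j, v j * Ax j y) + (∑ j, Mt j y * v j) + Et y * (‖v‖ ^ 2 / 2) +
        (∑ j, ∑ k, Mx j k y * (v j * v k)) + ∑ j, Ex j y * (v j * (‖v‖ ^ 2 / 2)))| ≤
      20 * L * (1 + ‖v‖ ^ 3) * Torus.euclidDist x y := by
  set d := Torus.euclidDist x y with hd
  have hd0 : 0 ≤ d := by rw [hd, Torus.euclidDist_eq]; exact norm_nonneg _
  set M := 1 + ‖v‖ ^ 3 with hM
  obtain ⟨hv1, hv2, hv2'⟩ := moments_le v
  have hvj : ∀ j, |v j| ≤ ‖v‖ := fun j => by simpa using PiLp.norm_apply_le v j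
  have hn := norm_nonneg v
  have hM1 : 1 ≤ M := le_add_of_nonneg_right (by positivity)
  have hv3 : ‖v‖ * (‖v‖ ^ 2 / 2) ≤ M := by rw [hM]; nlinarith [pow_nonneg hn 3]
  have hLd : 0 ≤ L * d := mul_nonneg hL hd0
  have e : (A0 x + (∑ j, v j * Ax j x) + (∑ j, Mt j x * v j) + Et x * (‖v‖ ^ 2 / 2) +
        (∑ j, ∑ k, Mx j k x * (v j * v k)) + ∑ j, Ex j x * (v j * (‖v‖ ^ 2 / 2))) -
      (A0 y + (∑ j, v j * Ax j y) + (∑ j, Mt j y * v j) + Et y * (‖v‖ ^ 2 / 2) +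
        (∑ j, ∑ k, Mx j k y * (v j * v k)) + ∑ j, Ex j y * (v j * (‖v‖ ^ 2 / 2))) =
      (A0 x - A0 y) + (∑ j, v j * (Ax j x - Ax j y)) + (∑ j, (Mt j x - Mt j y) * v j) +
        (Et x - Et y) * (‖v‖ ^ 2 / 2) + (∑ j, ∑ k, (Mx j k x - Mx j k y) * (v j * v k)) +
        ∑ j, (Ex j x - Ex j y) * (v j * (‖v‖ ^ 2 / 2)) := by
    simp only [sub_mul, mul_sub, Finset.sum_sub_distrib]
    ring
  rw [e]
  have b1 : |A0 x - A0 y| ≤ 1 * (L * d * M) := by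
    rw [one_mul]; exact (hA0 x y).trans (le_mul_of_one_le_right hLd hM1)
  have b2 : |∑ j, v j * (Ax j x - Ax j y)| ≤ 3 * (L * d * M) := by
    calc |∑ j, v j * (Ax j x - Ax j y)| ≤ ∑ j, |v j * (Ax j x - Ax j y)| :=
          Finset.abs_sum_le_sum_abs _ _
      _ ≤ ∑ _j : Fin 3, ‖v‖ * (L * d) := Finset.sum_le_sum fun j _ => by
          rw [abs_mul]; exact mul_le_mul (hvj j) (hAx j x y) (abs_nonneg _) hn
      _ = 3 * (L * d * ‖v‖) := by simp; ring
      _ ≤ 3 * (L * d * M) := by gcongr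
  have b3 : |∑ j, (Mt j x - Mt j y) * v j| ≤ 3 * (L * d * M) := by
    calc |∑ j, (Mt j x - Mt j y) * v j| ≤ ∑ j, |(Mt j x - Mt j y) * v j| :=
          Finset.abs_sum_le_sum_abs _ _
      _ ≤ ∑ _j : Fin 3, L * d * ‖v‖ := Finset.sum_le_sum fun j _ => by
          rw [abs_mul]; exact mul_le_mul (hMt j x y) (hvj j) (abs_nonneg _) hLd
      _ = 3 * (L * d * ‖v‖) := by simp
      _ ≤ 3 * (L * d * M) := by gcongr
  have b4 : |(Et x - Et y) * (‖v‖ ^ 2 / 2)| ≤ 1 * (L * d * M) := by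
    rw [abs_mul, abs_of_nonneg (by positivity : (0 : ℝ) ≤ ‖v‖ ^ 2 / 2), one_mul]
    exact mul_le_mul (hEt x y) hv2' (by positivity) hLd
  have b5 : |∑ j, ∑ k, (Mx j k x - Mx j k y) * (v j * v k)| ≤ 9 * (L * d * M) := by
    calc |∑ j, ∑ k, (Mx j k x - Mx j k y) * (v j * v k)|
        ≤ ∑ j, |∑ k, (Mx j k x - Mx j k y) * (v j * v k)| := Finset.abs_sum_le_sum_abs _ _
      _ ≤ ∑ j, ∑ k, |(Mx j k x - Mx j k y) * (v j * v k)| :=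
          Finset.sum_le_sum fun j _ => Finset.abs_sum_le_sum_abs _ _
      _ ≤ ∑ _j : Fin 3, ∑ _k : Fin 3, L * d * ‖v‖ ^ 2 :=
          Finset.sum_le_sum fun j _ => Finset.sum_le_sum fun k _ => by
            rw [abs_mul, abs_mul]
            calc |Mx j k x - Mx j k y| * (|v j| * |v k|) ≤ L * d * (‖v‖ * ‖v‖) :=
                  mul_le_mul (hMx j k x y) (mul_le_mul (hvj j) (hvj k) (abs_nonneg _) hn)
                    (by positivity) hLd
              _ = L * d * ‖v‖ ^ 2 := by ring
      _ = 9 * (L * d * ‖v‖ ^ 2) := by simp; ring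
      _ ≤ 9 * (L * d * M) := by gcongr
  have b6 : |∑ j, (Ex j x - Ex j y) * (v j * (‖v‖ ^ 2 / 2))| ≤ 3 * (L * d * M) := by
    calc |∑ j, (Ex j x - Ex j y) * (v j * (‖v‖ ^ 2 / 2))|
        ≤ ∑ j, |(Ex j x - Ex j y) * (v j * (‖v‖ ^ 2 / 2))| := Finset.abs_sum_le_sum_abs _ _
      _ ≤ ∑ _j : Fin 3, L * d * (‖v‖ * (‖v‖ ^ 2 / 2)) := Finset.sum_le_sum fun j _ => by
          rw [abs_mul, abs_mul, abs_of_nonneg (by positivity : (0 : ℝ) ≤ ‖v‖ ^ 2 / 2)]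
          exact mul_le_mul (hEx j x y) (mul_le_mul_of_nonneg_right (hvj j) (by positivity))
            (by positivity) hLd
      _ = 3 * (L * d * (‖v‖ * (‖v‖ ^ 2 / 2))) := by simp
      _ ≤ 3 * (L * d * M) := by gcongr
  have H : ∀ a b c d' e f : ℝ, |a + b + c + d' + e + f| ≤ |a| + |b| + |c| + |d'| + |e| + |f| := by
    intro a b c d' e f
    linarith [abs_add_le (a + b + c + d' + e) f, abs_add_le (a + b + c + d') e,
      abs_add_le (a + b + c) d', abs_add_le (a + b) c, abs_add_le a b]
  refine (H _ _ _ _ _ _).trans ?_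
  calc _ ≤ 20 * (L * d * M) := by linarith [b1, b2, b3, b4, b5, b6]
    _ = 20 * L * M * d := by ring

/-- Continuity in the position of the kinetic weight (continuous coefficients). -/
theorem continuous_kineticWeight {A0 Et : T3 → ℝ} {Ax Mt Ex : Fin 3 → T3 → ℝ}
    {Mx : Fin 3 → Fin 3 → T3 → ℝ} (hA0 : Continuous A0) (hEt : Continuous Et)
    (hAx : ∀ j, Continuous (Ax j)) (hMt : ∀ j, Continuous (Mt j)) (hEx : ∀ j, Continuous (Ex j))
    (hMx : ∀ j k, Continuous (Mx j k)) (v : V3) :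
    Continuous fun x => A0 x + (∑ j, v j * Ax j x) + (∑ j, Mt j x * v j) + Et x * (‖v‖ ^ 2 / 2) +
      (∑ j, ∑ k, Mx j k x * (v j * v k)) + ∑ j, Ex j x * (v j * (‖v‖ ^ 2 / 2)) := by
  fun_prop

/-- The block average `x ↦ ⟨emp w, φ(· − x) W(x, ·)⟩` of a weight continuous in the position is
integrable on the torus (a finite sum of continuous functions). -/
theorem integrable_smoothedWeight {φ : T3 → ℝ} (hφc : Continuous φ) (W : T3 → V3 → ℝ)
    (hWc : ∀ v, Continuous fun x => W x v) (w : Config (n + 1) (Fin 3) T3) :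
    Integrable (fun x => ∫ y, φ (y.1 - x) * W x y.2 ∂(empiricalMeasure w)) := by
  simp only [integral_empiricalMeasure]
  refine integrable_of_continuous_T3 (continuous_const.mul (continuous_finsetSum _ fun i _ => ?_))
  exact (hφc.comp (continuous_const.sub continuous_id)).mul (hWc _)

/-- The block average of the kinetic weight, in raw block functionals. -/
theorem smoothed_weight_eq (φ : T3 → ℝ) (w : Config (n + 1) (Fin 3) T3) (x : T3) (A0 Et : T3 → ℝ)
    (Ax Mt Ex : Fin 3 → T3 → ℝ) (Mx : Fin 3 → Fin 3 → T3 → ℝ) :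
    ∫ y, φ (y.1 - x) * (A0 x + (∑ j, y.2 j * Ax j x) + (∑ j, Mt j x * y.2 j) +
        Et x * (‖y.2‖ ^ 2 / 2) + (∑ j, ∑ k, Mx j k x * (y.2 j * y.2 k)) +
        ∑ j, Ex j x * (y.2 j * (‖y.2‖ ^ 2 / 2))) ∂(empiricalMeasure w) =
      A0 x * bρ φ w x + (∑ j, Ax j x * bm φ w x j) + (∑ j, Mt j x * bm φ w x j) + Et x * bE φ w x +
        (∑ j, ∑ k, Mx j k x * ∫ y, φ (y.1 - x) * (y.2 j * y.2 k) ∂(empiricalMeasure w)) +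
        ∑ j, Ex j x * ∫ y, φ (y.1 - x) * (‖y.2‖ ^ 2 / 2 * y.2 j) ∂(empiricalMeasure w) := by
  simp only [integral_weight_mul_eq_sum, bρ_eq_sum, bm_apply_eq_sum, bE_eq_sum, Fin.sum_univ_three,
    Finset.mul_sum, ← Finset.sum_add_distrib]
  exact Finset.sum_congr rfl fun i _ => by ring

/-- **The block average of the kinetic weight in the block fields** (exact kinetic-flux algebra
(B3) for the second and third moments). -/
theorem smoothed_weight_block {φ : T3 → ℝ} (hφ0 : ∀ y, 0 ≤ φ y) (w : Config (n + 1) (Fin 3) T3)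
    (x : T3) (A0 Et : T3 → ℝ) (Ax Mt Ex : Fin 3 → T3 → ℝ) (Mx : Fin 3 → Fin 3 → T3 → ℝ) :
    ∫ y, φ (y.1 - x) * (A0 x + (∑ j, y.2 j * Ax j x) + (∑ j, Mt j x * y.2 j) +
        Et x * (‖y.2‖ ^ 2 / 2) + (∑ j, ∑ k, Mx j k x * (y.2 j * y.2 k)) +
        ∑ j, Ex j x * (y.2 j * (‖y.2‖ ^ 2 / 2))) ∂(empiricalMeasure w) =
      A0 x * bρ φ w x + (∑ j, Ax j x * bm φ w x j) + (∑ j, Mt j x * bm φ w x j) + Et x * bE φ w x +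
        (∑ j, ∑ k, Mx j k x * (bρ φ w x * (bu φ w x j * bu φ w x k) +
          (if j = k then bρ φ w x * bθ φ w x else 0) + bD φ w x j k)) +
        ∑ j, Ex j x * ((bE φ w x + bρ φ w x * bθ φ w x) * bu φ w x j +
          (∑ k, bD φ w x j k * bu φ w x k) + bq φ w x j) := by
  obtain ⟨h2, h3⟩ := stub_balance_B3 n φ hφ0 w x
  rw [smoothed_weight_eq]
  simp only [h2, h3]

/-! ## The block production density -/

/-- The hs-Euler fluxes at the block state `Ū = (ρ̄, m̄, Ē)`: components, with the block pressure
`p̄ = hsPressure σ ρ̄ θ̄` (`stateTemp Ū = θ̄` definitionally). -/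
theorem eulerFlux_bU (σ : ℝ) (φ : T3 → ℝ) (w : Config (n + 1) (Fin 3) T3) (x : T3) :
    (∀ j, (eulerFlux σ j (bU φ w x)).1 = bm φ w x j) ∧
    (∀ j k, (eulerFlux σ j (bU φ w x)).2.1 k =
      bm φ w x j / bρ φ w x * bm φ w x k +
        hsPressure σ (bρ φ w x) (bθ φ w x) * (if k = j then 1 else 0)) ∧
    (∀ j, (eulerFlux σ j (bU φ w x)).2.2 =
      (bE φ w x + hsPressure σ (bρ φ w x) (bθ φ w x)) * bm φ w x j / bρ φ w x) := by
  have hθ : stateTemp (bU φ w x) = bθ φ w x := rfl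
  refine ⟨fun j => rfl, fun j k => ?_, fun j => ?_⟩
  · simp only [eulerFlux, hθ]
    simp only [bU, PiLp.add_apply, PiLp.smul_apply, smul_eq_mul, PiLp.single_apply]
  · simp only [eulerFlux, hθ]
    rfl

/-- **The pointwise identity.** On a block with `ρ̄ ≠ 0`, for arbitrary coefficients (the values of
the derivatives of the entropy variables at `(s, x)`): block production density
`= smoothed kinetic weight + collisional closure − kinetic remainder`; the block pressure
`p̄ = hsPressure σ ρ̄ θ̄` cancels exactly. -/
theorem pointwise_identity (σ : ℝ) (φ : T3 → ℝ) (w : Config (n + 1) (Fin 3) T3) (x : T3)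
    (hρ : bρ φ w x ≠ 0) (A0 Et : ℝ) (Ax Mt Ex : Fin 3 → ℝ) (Mx : Fin 3 → Fin 3 → ℝ) :
    (A0 * bρ φ w x + (∑ k, Mt k * bm φ w x k) + Et * bE φ w x) +
        ∑ j, (Ax j * (eulerFlux σ j (bU φ w x)).1 +
          (∑ k, Mx j k * (eulerFlux σ j (bU φ w x)).2.1 k) + Ex j * (eulerFlux σ j (bU φ w x)).2.2) =
      (A0 * bρ φ w x + (∑ j, Ax j * bm φ w x j) + (∑ j, Mt j * bm φ w x j) + Et * bE φ w x +
          (∑ j, ∑ k, Mx j k * (bρ φ w x * (bu φ w x j * bu φ w x k) +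
            (if j = k then bρ φ w x * bθ φ w x else 0) + bD φ w x j k)) +
          ∑ j, Ex j * ((bE φ w x + bρ φ w x * bθ φ w x) * bu φ w x j +
            (∑ k, bD φ w x j k * bu φ w x k) + bq φ w x j)) +
        ((∑ j, Mx j j) + ∑ j, Ex j * bu φ w x j) *
          (hsPressure σ (bρ φ w x) (bθ φ w x) - bρ φ w x * bθ φ w x) -
        ((∑ j, ∑ k, Mx j k * bD φ w x j k) +
          ∑ j, Ex j * ((∑ k, bD φ w x j k * bu φ w x k) + bq φ w x j)) := by
  obtain ⟨hF1, hF2, hF3⟩ := eulerFlux_bU σ φ w x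
  simp only [hF1, hF2, hF3, Fin.sum_univ_three, Fin.isValue, if_true, mul_one, mul_zero, add_zero, bu,
    PiLp.smul_apply, smul_eq_mul,
    show ((1 : Fin 3) = 0) = False by decide, show ((2 : Fin 3) = 0) = False by decide,
    show ((0 : Fin 3) = 1) = False by decide, show ((2 : Fin 3) = 1) = False by decide,
    show ((0 : Fin 3) = 2) = False by decide, show ((1 : Fin 3) = 2) = False by decide, if_false]
  field_simp
  ring

/-! ## The kinetic remainder -/

/-- **Pointwise bound of the kinetic remainder** by the kinetic defects: for coefficients bounded by
`L`, `|Σⱼₖ Mⱼₖ Dⱼₖ + Σⱼ Eⱼ (Σₖ Dⱼₖ uₖ + qⱼ)| ≤ 12 L (1 + ‖u‖) (Σⱼₖ Dⱼₖ² + ‖q‖²)^{1/2}`. -/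
theorem rem_abs_le {L : ℝ} (hL : 0 ≤ L) (Mx : Fin 3 → Fin 3 → ℝ) (Ex : Fin 3 → ℝ)
    (hMx : ∀ j k, |Mx j k| ≤ L) (hEx : ∀ j, |Ex j| ≤ L) (D : Fin 3 → Fin 3 → ℝ) (u q : V3) :
    |(∑ j, ∑ k, Mx j k * D j k) + ∑ j, Ex j * ((∑ k, D j k * u k) + q j)| ≤
      12 * L * (1 + ‖u‖) * Real.sqrt ((∑ j, ∑ k, D j k ^ 2) + ‖q‖ ^ 2) := by
  set S := (∑ j, ∑ k, D j k ^ 2) + ‖q‖ ^ 2 with hS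
  set R := Real.sqrt S with hR
  have hq : ‖q‖ ^ 2 = ∑ j, q j ^ 2 := EuclideanSpace.real_norm_sq_eq q
  have hDD : 0 ≤ ∑ j, ∑ k, D j k ^ 2 :=
    Finset.sum_nonneg fun _ _ => Finset.sum_nonneg fun _ _ => sq_nonneg _
  have hD : ∀ j k, |D j k| ≤ R := fun j k => Real.abs_le_sqrt (by
    have h1 : D j k ^ 2 ≤ ∑ k', D j k' ^ 2 :=
      Finset.single_le_sum (f := fun k' => D j k' ^ 2) (fun _ _ => sq_nonneg _) (Finset.mem_univ k)
    have h2 : ∑ k', D j k' ^ 2 ≤ ∑ j', ∑ k', D j' k' ^ 2 :=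
      Finset.single_le_sum (f := fun j' => ∑ k', D j' k' ^ 2)
        (fun _ _ => Finset.sum_nonneg fun _ _ => sq_nonneg _) (Finset.mem_univ j)
    rw [hS]; nlinarith [norm_nonneg q])
  have hqj : ∀ j, |q j| ≤ R := fun j => Real.abs_le_sqrt (by
    have h1 : q j ^ 2 ≤ ∑ j', q j' ^ 2 :=
      Finset.single_le_sum (f := fun j' => q j' ^ 2) (fun _ _ => sq_nonneg _) (Finset.mem_univ j)
    rw [hS, hq]; linarith)
  have huk : ∀ k, |u k| ≤ ‖u‖ := fun k => by simpa using PiLp.norm_apply_le u k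
  have hR0 : 0 ≤ R := Real.sqrt_nonneg _
  have hn := norm_nonneg u
  have t1 : |∑ j, ∑ k, Mx j k * D j k| ≤ 9 * (L * R) := by
    calc |∑ j, ∑ k, Mx j k * D j k| ≤ ∑ j, |∑ k, Mx j k * D j k| := Finset.abs_sum_le_sum_abs _ _
      _ ≤ ∑ j, ∑ k, |Mx j k * D j k| := Finset.sum_le_sum fun j _ => Finset.abs_sum_le_sum_abs _ _
      _ ≤ ∑ _j : Fin 3, ∑ _k : Fin 3, L * R := Finset.sum_le_sum fun j _ =>
          Finset.sum_le_sum fun k _ => by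
            rw [abs_mul]; exact mul_le_mul (hMx j k) (hD j k) (abs_nonneg _) hL
      _ = 9 * (L * R) := by simp; ring
  have t2 : |∑ j, Ex j * ((∑ k, D j k * u k) + q j)| ≤ 3 * (L * (3 * (R * ‖u‖) + R)) := by
    calc |∑ j, Ex j * ((∑ k, D j k * u k) + q j)| ≤ ∑ j, |Ex j * ((∑ k, D j k * u k) + q j)| :=
          Finset.abs_sum_le_sum_abs _ _
      _ ≤ ∑ _j : Fin 3, L * (3 * (R * ‖u‖) + R) := Finset.sum_le_sum fun j _ => by
          rw [abs_mul]
          refine mul_le_mul (hEx j) ?_ (abs_nonneg _) hL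
          calc |(∑ k, D j k * u k) + q j| ≤ |∑ k, D j k * u k| + |q j| := abs_add_le _ _
            _ ≤ (∑ k, |D j k * u k|) + R := add_le_add (Finset.abs_sum_le_sum_abs _ _) (hqj j)
            _ ≤ (∑ _k : Fin 3, R * ‖u‖) + R := by
                gcongr with k
                rw [abs_mul]; exact mul_le_mul (hD j k) (huk k) (abs_nonneg _) hR0
            _ = 3 * (R * ‖u‖) + R := by simp
      _ = 3 * (L * (3 * (R * ‖u‖) + R)) := by simp
  calc |(∑ j, ∑ k, Mx j k * D j k) + ∑ j, Ex j * ((∑ k, D j k * u k) + q j)|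
      ≤ |∑ j, ∑ k, Mx j k * D j k| + |∑ j, Ex j * ((∑ k, D j k * u k) + q j)| := abs_add_le _ _
    _ ≤ 9 * (L * R) + 3 * (L * (3 * (R * ‖u‖) + R)) := add_le_add t1 t2
    _ ≤ 12 * L * (1 + ‖u‖) * R := by nlinarith [mul_nonneg hL hR0, mul_nonneg (mul_nonneg hL hR0) hn]

end EngineBlockClosure

/-- Registered helper sub-goal `engine_blockClosure_commutator` of `engine_blockClosure`: the mollifier
commutator for velocity-dependent weights (`EngineBlockClosure.commutator_velocity`) — for a continuous
kernel `φ ≥ 0` of unit mass supported in `{euclidDist(·, 0) < r}` and a weight `W(x, v)` continuous and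
`K(1 + |v|³)`-Lipschitz in `x` (minimal-image distance),
`|⟨emp w, W⟩ − ∫ₓ ⟨emp w, φ(· − x) W(x, ·)⟩ dx| ≤ r K ⟨emp w, 1 + |v|³⟩`. [folklore] -/
theorem engine_blockClosure_commutator : ∀ {n : ℕ} (φ : T3 → ℝ) (r K : ℝ) (W : T3 → V3 → ℝ) (w : Config (n + 1) (Fin 3) T3), (∀ y, 0 ≤ φ y) → Continuous φ → ∫ y, φ y = 1 → (∀ y, r ≤ Torus.euclidDist y 0 → φ y = 0) → (∀ v, Continuous fun x => W x v) → 0 ≤ K → (∀ x y v, |W x v - W y v| ≤ K * (1 + ‖v‖ ^ 3) * Torus.euclidDist x y) → |(∫ y, W y.1 y.2 ∂(empiricalMeasure w)) - ∫ x, ∫ y, φ (y.1 - x) * W x y.2 ∂(empiricalMeasure w)| ≤ r * K * ∫ y, (1 + ‖y.2‖ ^ 3) ∂(empiricalMeasure w) :=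
  fun _ _ _ W w hφ0 hφc hφ1 hsupp hWc hK0 hW =>
    EngineBlockClosure.commutator_velocity hφ0 hφc hφ1 hsupp W hWc hK0 hW w

end Barycentric

end Summit.AtomisticToContinuum.HydrodynamicLimit.Theorems.MacroClosureLine

end
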